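import Mathlib
import Literature.Computability.AlgebraicComplexity.StandardFamilies
import Literature.Computability.AlgebraicComplexity.ArithCircuit
import Summits.ValiantsHypothesis.ValiantsHypothesis.Theses.DivisionGap

/-!
Sketch for crux-ideate stmt-ValiantsHypothesis-5068 (PerMultiplesHard), ideator 2, round 1.
First-lemma signatures of the idea cards (not proved here; they must only elaborate).
Convention of `perPoly`: `per = ∑_π ∏_i X (π i, i)`, so the pattern of `π` is `{(π i, i)}`.
-/

open MvPolynomial Literature.Computability.AlgebraicComplexity

namespace Summit.ValiantsHypothesis.ValiantsHypothesis.Cruxes.PerMultiplesHard.Sketch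

/-- FOUNDATION (both cards): over the semiring `ℝ≥0` initial forms are free — the lowest
`w`-weighted homogeneous component of `f` is computed by a circuit no larger than one for `f`
(prune every gate to its own initial form; no cancellation can occur). -/
def InitialFormLe : Prop :=
  ∀ (σ : Type) [Fintype σ] [DecidableEq σ] (w : σ → ℕ) (d : ℕ) (f : MvPolynomial σ NNReal),
    (∀ m ∈ f.support, d ≤ Finsupp.weight w m) →
      complexity (weightedHomogeneousComponent w d f) ≤ complexity f

/-- Positive substitutions are free as well (replace the input `X e` by the constant `1`). -/
def SubstOneLe : Prop :=
  ∀ (σ : Type) [Fintype σ] [DecidableEq σ] (e : σ) (f : MvPolynomial σ NNReal),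
    complexity (MvPolynomial.eval₂ (MvPolynomial.C) (fun i => if i = e then (1 : MvPolynomial σ NNReal) else X i) f)
      ≤ complexity f

/-- Torus (row/column) homogeneity: all monomials have the same row sums and column sums. -/
def IsTorusHomogeneous {n : ℕ} (g : MvPolynomial (Fin n × Fin n) NNReal) : Prop :=
  ∃ r c : Fin n → ℕ, ∀ m ∈ g.support, (∀ a, ∑ b, m (a, b) = r a) ∧ (∀ b, ∑ a, m (a, b) = c b)

/-- The permutations `π` such that some monomial of `g` has pattern EXACTLY the graph of `π`
("thin" monomials, e.g. `k • permMonomial π`). -/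
noncomputable def thinPerms {n : ℕ} (g : MvPolynomial (Fin n × Fin n) NNReal) :
    Finset (Equiv.Perm (Fin n)) :=
  Finset.univ.filter fun π => ∃ m ∈ g.support, ∀ a b, m (a, b) ≠ 0 ↔ π b = a

/-- CARD 1 (typed gates / thin patterns), first lemma: after free torus-homogenisation every
gate has ONE torus type `(ρ, γ)`; the parse chain of a thin monomial of pattern `π` passes a gate
with `n/3 < |supp ρ| ≤ 2n/3` and `π(supp ρ) = supp γ`, and one type serves at most `k!(n-k)! ≤
n!/C(n,⌊n/3⌋)` permutations. Hence `#thin · C(n,⌊n/3⌋) ≤ size · n!`. -/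
def ThinPatternBound : Prop :=
  ∀ n ≥ 3, ∀ g : MvPolynomial (Fin n × Fin n) NNReal, IsTorusHomogeneous g →
    (thinPerms g).card * Nat.choose n (n / 3) ≤ complexity g * Nat.factorial n

/-- CARD 1, immediate corollary (new rung, uniform in the exponent): all powers of the permanent
are monotone-hard, `L₊(per_n ^ k) ≥ C(n, ⌊n/3⌋)` for every `k ≥ 1`. -/
def PerPowLower : Prop :=
  ∀ n ≥ 3, ∀ k ≥ 1, Nat.choose n (n / 3) ≤ complexity ((perPoly (Fin n) NNReal) ^ k)

/-- CARD 1, corollary for the crux: if (a torus component of) `h` contains `d • permMonomial σ`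
for all `σ` (e.g. `h = per^d`, `h` = the `(d,…,d)`-component of `(∑ X)^{dn}`), then
`L₊(per · h) ≥ C(n,⌊n/3⌋)`; stated here for torus-homogeneous `h` whose thin set is everything. -/
def AlignedMultiplesHard : Prop :=
  ∀ n ≥ 3, ∀ h : MvPolynomial (Fin n × Fin n) NNReal, IsTorusHomogeneous h →
    thinPerms h = Finset.univ →
      Nat.choose n (n / 3) ≤ complexity (perPoly (Fin n) NNReal * h)

/-- The permanent of a bipartite graph `G ⊆ [n] × [n]` (faces of the Birkhoff polytope), in the
column-major convention of `perPoly`. -/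
noncomputable def perOn {n : ℕ} (G : Finset (Fin n × Fin n)) : MvPolynomial (Fin n × Fin n) NNReal :=
  ∑ π ∈ Finset.univ.filter (fun π : Equiv.Perm (Fin n) => ∀ i, (π i, i) ∈ G), ∏ i, X (π i, i)

/-- CARD 2 (Birkhoff face walk), first lemma — ONE STEP OF THE WALK: degenerating with the weight
`w = 𝟙_e` replaces `per(G)` by `per(G - e)` (a facet of the face `DS(G)`) and `h` by its
`e`-minimal part, from which `X e` then factors out and is set to `1`; the new multiplier `h'`
no longer involves `e`. Valid whenever `G - e` still has a perfect matching. -/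
def EdgeDeletion : Prop :=
  ∀ (n : ℕ) (G : Finset (Fin n × Fin n)) (e : Fin n × Fin n)
    (h : MvPolynomial (Fin n × Fin n) NNReal),
    h ≠ 0 → (∃ π : Equiv.Perm (Fin n), ∀ i, (π i, i) ∈ G.erase e) →
      ∃ h' : MvPolynomial (Fin n × Fin n) NNReal, h' ≠ 0 ∧ h'.vars ⊆ h.vars.erase e ∧
        complexity (perOn (G.erase e) * h') ≤ complexity (perOn G * h)

/-- CARD 2, the rung it yields at once (walk = delete all of `vars h`): multipliers whose
variable set meets every row and every column in at most `n / (4 log₂ n + 4)` cells cannot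
help — `per · h` stays exponentially hard (M. Hall's `d!` matchings + Jerrum–Snir content bound
for `per(K \ vars h)`). -/
def SparseMultiplesHard : Prop :=
  ∀ n ≥ 3, ∀ h : MvPolynomial (Fin n × Fin n) NNReal, h ≠ 0 →
    (∀ a : Fin n, (h.vars.filter fun e => e.1 = a).card * (4 * Nat.log 2 n + 4) ≤ n) →
    (∀ b : Fin n, (h.vars.filter fun e => e.2 = b).card * (4 * Nat.log 2 n + 4) ≤ n) →
      2 ^ (n / 2) ≤ complexity (perPoly (Fin n) NNReal * h)


/-! ### Card `typed-parse-tree-weights` -/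

/-- The torus TYPE of an exponent table: (row sums, column sums). -/
def typeOf {n : ℕ} (m : Fin n × Fin n →₀ ℕ) : (Fin n → ℕ) × (Fin n → ℕ) :=
  (fun a => ∑ b, m (a, b), fun b => ∑ a, m (a, b))

/-- Typed content of `g` at a split `(τ₁, τ₂)`: the largest `|A|·|B|·|C|` over nonempty finite sets of
exponent tables with `A` of type `τ₁`, `B` of type `τ₂` and `A + B + C ⊆ supp g` (Jerrum–Snir's content,
indexed by torus types instead of degrees; `C` is then automatically of type `type g − τ₁ − τ₂`). -/
noncomputable def typedContent {n : ℕ} (g : MvPolynomial (Fin n × Fin n) NNReal)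
    (τ₁ τ₂ : (Fin n → ℕ) × (Fin n → ℕ)) : ℕ :=
  sSup {k : ℕ | ∃ A B C : Finset (Fin n × Fin n →₀ ℕ), A.Nonempty ∧ B.Nonempty ∧ C.Nonempty ∧
    (∀ a ∈ A, typeOf a = τ₁) ∧ (∀ b ∈ B, typeOf b = τ₂) ∧
    (∀ a ∈ A, ∀ b ∈ B, ∀ c ∈ C, a + b + c ∈ g.support) ∧ k = A.card * B.card * C.card}

/-- CARD `typed-parse-tree-weights`, first lemma (typed Jerrum–Snir, JS82 Thm 3.3–3.4 + Cor 3.5 with types, through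
PlainBridge): a weight function on types that vanishes on inputs and is sub-additive up to the reciprocal typed
content certifies `|supp g| · w(type g) ≤ 2 (K+1) · L₊(g)` for torus-homogeneous `g` whose exponents are bounded by
`K` (the factor `K+1` pays for parse-tree nodes repeated across branches — the in-tree JS file assumes a multilinear
target, `disjoint_subTree`; a node `(α, m_α)` can occur at most `K` times in the parse tree of `m` since `t • m_α ≤ m`). -/
def TypedWeightBound : Prop :=
  ∀ (n K : ℕ) (g : MvPolynomial (Fin n × Fin n) NNReal) (τg : (Fin n → ℕ) × (Fin n → ℕ)),
    (∀ m ∈ g.support, typeOf m = τg) → (∀ m ∈ g.support, ∀ e, m e ≤ K) →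
    ∀ w : (Fin n → ℕ) × (Fin n → ℕ) → ℝ,
      w (typeOf (0 : Fin n × Fin n →₀ ℕ)) ≤ 0 →
      (∀ e : Fin n × Fin n, w (typeOf (Finsupp.single e 1)) ≤ 0) →
      (∀ τ₁ τ₂, w (τ₁ + τ₂) ≤ w τ₁ + w τ₂ + 1 / (typedContent g τ₁ τ₂ : ℝ)) →
        (g.support.card : ℝ) * w τg ≤ 2 * (K + 1) * (complexity g : ℝ)

/-- The first aligned ∧ ½-fat cofactor: far pairs of permutation monomials,
`h_far = Σ_{π,ρ : #{i : π i ≠ ρ i} ≥ n/2} x^{P_π} x^{P_ρ}` (= per² minus its near-diagonal part). -/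
noncomputable def hFar (n : ℕ) : MvPolynomial (Fin n × Fin n) NNReal :=
  ∑ p ∈ (Finset.univ : Finset (Equiv.Perm (Fin n) × Equiv.Perm (Fin n))).filter
      (fun p => n ≤ 2 * (Finset.univ.filter fun i => p.1 i ≠ p.2 i).card),
    (∏ i, X (p.1 i, i)) * ∏ i, X (p.2 i, i)

/-- CARD `typed-parse-tree-weights`, target rung: the far-pairs multiple of the permanent is exponentially hard
(rate deliberately weak: the typed LP is expected to certify about `2^n / Bregman₃^n ≈ 1.1^n`). -/
def FarPairsMultipleHard : Prop :=
  ∃ n₀ : ℕ, ∀ n ≥ n₀, (11 : ℝ) ^ n ≤ 10 ^ n * ((complexity (perPoly (Fin n) NNReal * hFar n) : ℝ) + 1)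

/-- CARD `typed-parse-tree-weights`, the clean theorem it would give first: EVERY nonzero nonnegative combination
of permutation monomials is a useless cofactor (margins ≤ 1 after the torus step; typed LP rate `2^n / poly`). -/
def PermutationSumCofactorsHard : Prop :=
  ∀ n ≥ 3, ∀ c : Equiv.Perm (Fin n) → NNReal, c ≠ 0 →
    2 ^ (n / 2) ≤ (n + 1) ^ 4 * (complexity (perPoly (Fin n) NNReal *
      ∑ π, c π • ∏ i, (X (π i, i) : MvPolynomial (Fin n × Fin n) NNReal)) + 1)

/-- Sanity: the crux decl is in scope (the cards conclude it BY NAME downstream). -/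
example : Prop := Summit.ValiantsHypothesis.ValiantsHypothesis.Theses.DivisionGap.PerMultiplesHard

end Summit.ValiantsHypothesis.ValiantsHypothesis.Cruxes.PerMultiplesHard.Sketch
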